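import Summits.BirchSwinnertonDyer.Rank1Residual.Additive.KatoDescentRankOneCountRows
import Summits.BirchSwinnertonDyer.Rank1Residual.Additive.KatoDescentRealizableContraOfFactsImai
import Literature.NumberTheory.EllipticCurves.Kato2004.IwasawaH2FineSelmerDualLoc
import Literature.NumberTheory.EllipticCurves.CuspFormLFunctionLevelConductorProofs
import HarnessLib

set_option autoImplicit false

/-!
# STUBS 3 AND 4 OF THE KATO–PERRIN-RIOU SKELETONS, ON THE TWO CRUXES' ROWS, BY NAME from four Literature facts
# {GZK, lev, `Kato2004.thm12_4`, H2X′ = `Kato2004.exists_iwasawaH2Data_fineSelmerDual_embedding_loc`} (seat `bsd-cm-prr-ty1` g16, cell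
# `bsd-cm`; theorems only: no definition, no named fact, no instance, no `sorry`)

Part 49 of the seat's kernel cut (cruxes stmt-BirchSwinnertonDyer-19945 / -19223).  Part 48 (`KatoDescentRankOneCountRows.lean`) proves the
v5-recut body of stub 3 on the rows of 19223 (`(p, I₀*)`, `p ≥ 5`) and of 19945 (𝒞₇ × {7}) from {GZK, lev, `thm12_4`} + the DISPLAY H2X′;
the display is now the Literature named fact `Kato2004.exists_iwasawaH2Data_fineSelmerDual_embedding_loc`
(`Literature/…/Kato2004/IwasawaH2FineSelmerDualLoc.lean`, this seat; Kato (14.9.1) → (17.13.1) + the display after (12.2.3)), whose text IS the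
display verbatim — so every theorem here is a ONE-LINE re-key BY NAME:
* `rankOneCountReading_istarZero_of_named_facts` / `rankOneCountReading_classCSeven_of_named_facts` — stub 3's body on the rows of 19223 /
  19945 ⟸ {GZK, lev, `thm12_4`, H2X′};
* `rankOneCountReading_tame_of_named_facts` / `…_cm_tame_…` — Part 37's tame rows, the same four names;
* `countX₀_tame_of_named_facts` — the display COUNT-X₀|tame ⟸ {GZK, `thm12_4`, H2X′};
* `realizableOfKMC_contra_of_thm12_4_of_loc` — STUB 4's type `TorsionFree.RealizableOfKMC IsKatoZetaDescentDatumOfContra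
  KatoMainConjectureFineContra` VERBATIM ⟸ {`thm12_4`, H2X′} (Part 21 `ContraRealizable.realizableOfKMC_contra_of_thm12_4_of_h2Embedding` fed with
  the corollary `.embedding : H2X′ → H2X`);
* §5 `exists_linearEquiv_fineSelmerDual_H2_of_noPTorsionPadic` (+ `_of_hasSignedLocalType_IstarZero`): on every row with `W(ℚ_p)[p] = 0` (p odd,
  κ cyclotomic) some package `J` over each pin has `X₀(E/ℚ_∞) ≃ₗ[Λ] J.H2` — H2X′ + the tree vanishing theorem (cell bsd-potss's «tame short-cut», by name);
* `…_of_modularity` variants: the level input `lev` (Carayol) is supplied by the modularity-with-level fact `exists_isNewformOf` through the tree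
  theorem `IsNewformOf.level_eq_conductorNorm_of_exists_isNewformOf'` (strong multiplicity one across levels, proved in the tree), so the rows'
  readings also hold from {GZK, `exists_isNewformOf`, `thm12_4`, H2X′}.
READING OF RECORD after this file: on every row of both cruxes, stub 3 (v5-recut body) ⟸ {GZK, lev (or `exists_isNewformOf`), `thm12_4`, H2X′}
and stub 4 ⟸ {`thm12_4`, H2X′} — FOUR NAMED PRINT FACTS of the Literature layer, no display, no binder left; the two RESEARCH stubs 1–2
(Perrin-Riou up to a unit; Kato's Main Conjecture 12.10, fine, contragredient key) are untouched.  HONEST LABEL: theorems only; the registered v4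
stubs are NOT closed (stub 3's registered binders are unrestricted; recut = planner/lead act ASK #3 (ρ4′)); nothing is asserted on 19945 / 19223;
the four facts are hypotheses (unproved in the tree); no summit statement is proved by this file; BSD is not proved for any curve.
References: [Kato2004Asterisque] Thm. 12.4 (p. 221), Thm. 12.5 (p. 222), §13.9 (p. 230), (14.9.1) (p. 239), (14.9.3) (p. 240), §14.14 (p. 243),
Prop. 14.16 (p. 244), (17.13.1) (p. 279); [Mazur1977] Ch. III §5 Step 1; [BurnsKuriharaSano2019] Thm. 7.3, 7.8 (d); [GrossZagier1986] Thm. I.7.3;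
[BreuilConradDiamondTaylor2001] Thm. A; [DiamondShurman2005] Thm. 8.8.1–8.8.3; [Carayol1986].
-/

noncomputable section

open scoped Classical NumberField BigOperators ContRepresentation

open WeierstrassCurve Field IsDedekindDomain NumberField Rat.HeightOneSpectrum Literature.NumberTheory.EllipticCurves
  Literature.NumberTheory.EllipticCurves.ModularForms
  Literature.NumberTheory.EllipticCurves.Rank1Residual Literature.NumberTheory.EllipticCurves.Rank1Residual.Typed
  Literature.NumberTheory.EllipticCurves.Kato2004 Literature.NumberTheory.EllipticCurves.IwasawaAlgebra
  Literature.NumberTheory.EllipticCurves.Kato2004.EulerSystemValues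
  Literature.NumberTheory.GaloisRepresentations Literature.NumberTheory.GaloisRepresentations.DiscreteGaloisModule
  Literature.NumberTheory.DiophantineGeometry
open Summit.BirchSwinnertonDyer.Rank1Residual Summit.BirchSwinnertonDyer.Rank1Residual.Additive
  Summit.BirchSwinnertonDyer.Rank1Residual.X12.O10

namespace Summit.BirchSwinnertonDyer.Rank1Residual.Additive.StrictCount

/-! ## §1 The level input from modularity -/

/-- Carayol's level theorem in the shape of the rows' `hlev` binder, from the modularity-with-level fact `exists_isNewformOf`
(tree `IsNewformOf.level_eq_conductorNorm_of_exists_isNewformOf'`: strong multiplicity one across levels).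
[cite: BreuilConradDiamondTaylor2001, Thm. A] [cite: DiamondShurman2005, Thm. 8.8.1 and Thm. 8.8.3] -/
theorem hlev_of_modularity (hmod : exists_isNewformOf) : ∀ (N : ℕ) [NeZero N], IsNewformOf.level_eq_conductorNorm (N := N) :=
  fun N _ ↦ IsNewformOf.level_eq_conductorNorm_of_exists_isNewformOf' (N := N) hmod

/-! ## §2 Stub 3 on the rows, by name -/

section Rows

/-- **STUB 3 ON THE ROWS OF 19223 from the four NAMED facts {GZK, lev, `thm12_4`, H2X′}.**  Part 48's
`rankOneCountReading_istarZero_of_facts` with its display fed by the Literature fact `Kato2004.exists_iwasawaH2Data_fineSelmerDual_embedding_loc`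
(same text).  CONDITIONAL; the registered v4 stub is NOT closed; nothing asserted on 19223.
[cite: Kato2004Asterisque, Thm. 12.4 (p. 221), §13.9 (p. 230), (14.9.1) (p. 239), (14.9.3) (p. 240), §14.14 (p. 243), Prop. 14.16 (p. 244), (17.13.1) (p. 279)]
[cite: Mazur1977, Ch. III §5, Step 1, p. 158] [cite: GrossZagier1986, Thm. I.7.3] -/
theorem rankOneCountReading_istarZero_of_named_facts
    (hGZK : rank_eq_analyticRank_of_analyticRank_le_one)
    (hlev : ∀ (N : ℕ) [NeZero N], IsNewformOf.level_eq_conductorNorm (N := N))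
    (h12 : Kato2004.thm12_4) (hH2X' : Kato2004.exists_iwasawaH2Data_fineSelmerDual_embedding_loc) :
    ∀ (p : ℕ) [Fact p.Prime], 5 ≤ p → ∀ (W : WeierstrassCurve ℚ) [W.IsElliptic] [W.IsGloballyMinimal],
      HasSignedLocalType W p (.Istar 0) → W.analyticRank = 1 →
      ∀ (D : KatoDescentDatum p) (ℒ : ℚ_[p]),
        IsKatoZetaDescentDatumOfContra W p D → Kato2004.PRRatio W p ℒ →
        Finite (coinvariants p D.H2) ∧ (ℒ ≠ 0 ↔ D.zetaIndex ≠ 0) ∧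
          ∀ m : ℕ, D.zetaIndex = p ^ m * D.h2Card →
            ℒ.valuation = (m : ℤ) +
              padicValNat p (Nat.card (AddCommGroup.primaryComponent W.sha p)) +
              padicValNat p W.tamagawaProduct :=
  rankOneCountReading_istarZero_of_facts hGZK hlev h12 hH2X'

/-- … the same from {GZK, `exists_isNewformOf` (modularity with level), `thm12_4`, H2X′}.
[cite: Kato2004Asterisque, Thm. 12.4 (p. 221), (14.9.1) (p. 239), Prop. 14.16 (p. 244)] [cite: BreuilConradDiamondTaylor2001, Thm. A] -/
theorem rankOneCountReading_istarZero_of_modularity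
    (hGZK : rank_eq_analyticRank_of_analyticRank_le_one) (hmod : exists_isNewformOf)
    (h12 : Kato2004.thm12_4) (hH2X' : Kato2004.exists_iwasawaH2Data_fineSelmerDual_embedding_loc) :
    ∀ (p : ℕ) [Fact p.Prime], 5 ≤ p → ∀ (W : WeierstrassCurve ℚ) [W.IsElliptic] [W.IsGloballyMinimal],
      HasSignedLocalType W p (.Istar 0) → W.analyticRank = 1 →
      ∀ (D : KatoDescentDatum p) (ℒ : ℚ_[p]),
        IsKatoZetaDescentDatumOfContra W p D → Kato2004.PRRatio W p ℒ →
        Finite (coinvariants p D.H2) ∧ (ℒ ≠ 0 ↔ D.zetaIndex ≠ 0) ∧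
          ∀ m : ℕ, D.zetaIndex = p ^ m * D.h2Card →
            ℒ.valuation = (m : ℤ) +
              padicValNat p (Nat.card (AddCommGroup.primaryComponent W.sha p)) +
              padicValNat p W.tamagawaProduct :=
  rankOneCountReading_istarZero_of_facts hGZK (hlev_of_modularity hmod) h12 hH2X'

/-- **STUB 3 ON THE ROWS OF 19945 from the four NAMED facts {GZK, lev, `thm12_4`, H2X′}** (Part 48's
`rankOneCountReading_classCSeven_of_facts` fed by the Literature fact).  CONDITIONAL; the registered v4 stub is NOT closed; nothing asserted on 19945.
[cite: Kato2004Asterisque, Thm. 12.4 (p. 221), §13.9 (p. 230), (14.9.1) (p. 239), (14.9.3) (p. 240), §14.14 (p. 243), Prop. 14.16 (p. 244), (17.13.1) (p. 279)]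
[cite: Mazur1977, Ch. III §5, Step 1, p. 158] [cite: GrossZagier1986, Thm. I.7.3] -/
theorem rankOneCountReading_classCSeven_of_named_facts
    (hGZK : rank_eq_analyticRank_of_analyticRank_le_one)
    (hlev : ∀ (N : ℕ) [NeZero N], IsNewformOf.level_eq_conductorNorm (N := N))
    (h12 : Kato2004.thm12_4) (hH2X' : Kato2004.exists_iwasawaH2Data_fineSelmerDual_embedding_loc) :
    ∀ (W : WeierstrassCurve ℚ) [W.IsElliptic] [W.IsGloballyMinimal] [Fact (Nat.Prime 7)],
      X12.ClassCSeven W →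
      ∀ (D : KatoDescentDatum 7) (ℒ : ℚ_[7]),
        IsKatoZetaDescentDatumOfContra W 7 D → Kato2004.PRRatio W 7 ℒ →
        Finite (coinvariants 7 D.H2) ∧ (ℒ ≠ 0 ↔ D.zetaIndex ≠ 0) ∧
          ∀ m : ℕ, D.zetaIndex = 7 ^ m * D.h2Card →
            ℒ.valuation = (m : ℤ) +
              padicValNat 7 (Nat.card (AddCommGroup.primaryComponent W.sha 7)) +
              padicValNat 7 W.tamagawaProduct :=
  rankOneCountReading_classCSeven_of_facts hGZK hlev h12 hH2X'

/-- … the same from {GZK, `exists_isNewformOf`, `thm12_4`, H2X′}.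
[cite: Kato2004Asterisque, Thm. 12.4 (p. 221), (14.9.1) (p. 239), Prop. 14.16 (p. 244)] [cite: BreuilConradDiamondTaylor2001, Thm. A] -/
theorem rankOneCountReading_classCSeven_of_modularity
    (hGZK : rank_eq_analyticRank_of_analyticRank_le_one) (hmod : exists_isNewformOf)
    (h12 : Kato2004.thm12_4) (hH2X' : Kato2004.exists_iwasawaH2Data_fineSelmerDual_embedding_loc) :
    ∀ (W : WeierstrassCurve ℚ) [W.IsElliptic] [W.IsGloballyMinimal] [Fact (Nat.Prime 7)],
      X12.ClassCSeven W →
      ∀ (D : KatoDescentDatum 7) (ℒ : ℚ_[7]),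
        IsKatoZetaDescentDatumOfContra W 7 D → Kato2004.PRRatio W 7 ℒ →
        Finite (coinvariants 7 D.H2) ∧ (ℒ ≠ 0 ↔ D.zetaIndex ≠ 0) ∧
          ∀ m : ℕ, D.zetaIndex = 7 ^ m * D.h2Card →
            ℒ.valuation = (m : ℤ) +
              padicValNat 7 (Nat.card (AddCommGroup.primaryComponent W.sha 7)) +
              padicValNat 7 W.tamagawaProduct :=
  rankOneCountReading_classCSeven_of_facts hGZK (hlev_of_modularity hmod) h12 hH2X'

end Rows

/-! ## §3 The tame rows and the COUNT display, by name -/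

section TameNamed

/-- **STUB 3 ON THE TAME ALL-ADDITIVE ROWS from the four NAMED facts** (Part 48's `rankOneCountReading_tame_of_lev_of_thm12_4` fed by the
Literature fact).  Conclusion VERBATIM Part 37's.  CONDITIONAL; the registered v4 stub is NOT closed.
[cite: Kato2004Asterisque, Thm. 12.4 (p. 221), (14.9.1) (p. 239), (14.9.3) (p. 240), §14.14 (p. 243), Prop. 14.16 (p. 244), (17.13.1) (p. 279)] -/
theorem rankOneCountReading_tame_of_named_facts
    (hGZK : rank_eq_analyticRank_of_analyticRank_le_one)
    (hlev : ∀ (N : ℕ) [NeZero N], IsNewformOf.level_eq_conductorNorm (N := N))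
    (h12 : Kato2004.thm12_4) (hH2X' : Kato2004.exists_iwasawaH2Data_fineSelmerDual_embedding_loc) :
    ∀ (W : WeierstrassCurve ℚ) [W.IsElliptic] [W.IsGloballyMinimal] (p : ℕ) [Fact p.Prime]
      (D : KatoDescentDatum p) (ℒ : ℚ_[p]),
      W.analyticRank = 1 → p ≠ 2 → Addv W p → 0 ≤ padicValRat p W.j → ¬ p ∣ W.torsionOrder →
      Finite W.sha →
      (∀ v ∈ W.badPlaces (𝓞 ℚ), ((Rat.HeightOneSpectrum.primesEquiv v : Nat.Primes) : ℕ) ≠ p →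
        W.HasAdditiveReductionAt v) →
      (∀ R : (W.baseChange ℚ_[p]).toAffine.Point, p • R = 0 → R = 0) →
      IsKatoZetaDescentDatumOfContra W p D → Kato2004.PRRatio W p ℒ →
      Finite (coinvariants p D.H2) ∧ (ℒ ≠ 0 ↔ D.zetaIndex ≠ 0) ∧
        ∀ m : ℕ, D.zetaIndex = p ^ m * D.h2Card →
          ℒ.valuation = (m : ℤ) +
            padicValNat p (Nat.card (AddCommGroup.primaryComponent W.sha p)) +
            padicValNat p W.tamagawaProduct :=
  rankOneCountReading_tame_of_lev_of_thm12_4 hGZK hlev h12 hH2X'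

/-- **STUB 3 ON THE TAME CM ROWS from the four NAMED facts** (Part 48's `rankOneCountReading_cm_tame_of_lev_of_thm12_4` fed by the
Literature fact).  Conclusion VERBATIM Part 37's.  CONDITIONAL; the registered v4 stub is NOT closed.
[cite: Kato2004Asterisque, Thm. 12.4 (p. 221), (14.9.3) (p. 240), §14.14 (p. 243), Prop. 14.16 (p. 244), (17.13.1) (p. 279)] -/
theorem rankOneCountReading_cm_tame_of_named_facts
    (hGZK : rank_eq_analyticRank_of_analyticRank_le_one)
    (hlev : ∀ (N : ℕ) [NeZero N], IsNewformOf.level_eq_conductorNorm (N := N))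
    (h12 : Kato2004.thm12_4) (hH2X' : Kato2004.exists_iwasawaH2Data_fineSelmerDual_embedding_loc) :
    ∀ (W : WeierstrassCurve ℚ) [W.IsElliptic] [W.IsGloballyMinimal] (p : ℕ) [Fact p.Prime]
      (D : KatoDescentDatum p) (ℒ : ℚ_[p]),
      W.analyticRank = 1 → p ≠ 2 → Addv W p → 0 ≤ padicValRat p W.j → ¬ p ∣ W.torsionOrder →
      Finite W.sha →
      W.HasCM →
      (∀ R : (W.baseChange ℚ_[p]).toAffine.Point, p • R = 0 → R = 0) →
      IsKatoZetaDescentDatumOfContra W p D → Kato2004.PRRatio W p ℒ →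
      Finite (coinvariants p D.H2) ∧ (ℒ ≠ 0 ↔ D.zetaIndex ≠ 0) ∧
        ∀ m : ℕ, D.zetaIndex = p ^ m * D.h2Card →
          ℒ.valuation = (m : ℤ) +
            padicValNat p (Nat.card (AddCommGroup.primaryComponent W.sha p)) +
            padicValNat p W.tamagawaProduct :=
  rankOneCountReading_cm_tame_of_lev_of_thm12_4 hGZK hlev h12 hH2X'

/-- **COUNT-X₀|tame from the NAMED facts {GZK, `thm12_4`, H2X′}** (Part 37's `countX₀_tame_of_gzk_of_thm12_4_of_h2x'` fed by the Literature
fact).  Conclusion VERBATIM Part 37's §2. [cite: Kato2004Asterisque, Thm. 12.4 (p. 221), (14.9.1) (p. 239), (14.9.3) (p. 240), §14.14 (14.14.1)–(14.14.2) (p. 243), (17.13.1) (p. 279)]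
[cite: GreenbergLNM1716, §3 Lemma 3.1, Lemma 3.2 and Prop. 3.8] -/
theorem countX₀_tame_of_named_facts (hGZK : rank_eq_analyticRank_of_analyticRank_le_one) (h12 : Kato2004.thm12_4)
    (hH2X' : Kato2004.exists_iwasawaH2Data_fineSelmerDual_embedding_loc) :
    ∀ (W : WeierstrassCurve ℚ) [W.IsElliptic] [W.IsGloballyMinimal] (p : ℕ) [Fact p.Prime],
      letI : ContinuousSMul ℤ_[p] (W.tateModule p) := TateModule.continuousSMul_padicInt
      ∀ (κ : ZpExtension ℚ p) (γ : absoluteGaloisGroup ℚ), κ.IsCyclotomic → (hγ : κ.IsTopGenerator γ) →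
        ∀ (I : IwasawaH1Data W p κ γ) (J₀ : IwasawaH2Data W p κ γ I)
          (e₀ : (W.fineSelmerDualData κ hγ).X →ₗ[IwasawaAlgebra p] J₀.H2),
          W.analyticRank = 1 → p ≠ 2 → Addv W p → 0 ≤ padicValRat p W.j → ¬ p ∣ W.torsionOrder → Finite W.sha →
          (∀ R : (W.baseChange ℚ_[p]).toAffine.Point, p • R = 0 → R = 0) →
          Function.Injective e₀ → Finite (J₀.H2 ⧸ LinearMap.range e₀) →
          KatoH2CountAt W p (Nat.card (coinvariants p J₀.H2)) :=
  countX₀_tame_of_gzk_of_thm12_4_of_h2x' hGZK h12 hH2X'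

end TameNamed

/-! ## §4 Stub 4, by name -/

section StubFour

/-- **STUB 4 `stub_realizableOfKMCFine` (both skeletons; type VERBATIM) from the NAMED facts {`Kato2004.thm12_4`, H2X′}**: Part 21's
`ContraRealizable.realizableOfKMC_contra_of_thm12_4_of_h2Embedding` (residual {`thm12_4`, H2X}) with H2X supplied by the corollary
`exists_iwasawaH2Data_fineSelmerDual_embedding_loc.embedding` (H2X′ ⟹ H2X).  CONDITIONAL on the two named facts; the registered stub is NOT
closed by this file (closing it is a ledger act on the facts); nothing asserted on 19945 / 19223.
[cite: Kato2004Asterisque, Thm. 12.4 (p. 221), Thm. 12.5 (p. 222), §14.14 (p. 243), (14.9.1) (p. 239), (17.13.1) (p. 279)] -/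
theorem realizableOfKMC_contra_of_thm12_4_of_loc (h12 : Kato2004.thm12_4)
    (hH2X' : Kato2004.exists_iwasawaH2Data_fineSelmerDual_embedding_loc) :
    TorsionFree.RealizableOfKMC IsKatoZetaDescentDatumOfContra KatoMainConjectureFineContra :=
  ContraRealizable.realizableOfKMC_contra_of_thm12_4_of_h2Embedding h12 hH2X'.embedding

end StubFour

/-! ## §5 On the tame rows Kato's `𝐇²`-package IS `X₀(E/ℚ_∞)` (cell bsd-potss's «tame short-cut», by name) -/

section TameShortCut

/-- **`W(ℚ_p)[p] = 0` ⟹ `X₀(E/ℚ_∞) ≃ₗ[Λ] 𝐇²_Γ(T_pW)` for some package over every pin** (`p` odd, `κ` cyclotomic): the Literature fact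
H2X′ (corollary `.exists_linearEquiv_of_eq_bot`) fed with the tree theorem
`TowerTorsionVanishing.fixedPoints_kerSubgroup_inf_decomp_eq_bot_of_noPTorsionPadic` (`W(ℚ_{p,∞})[p^∞] = 0` from `W(ℚ_p)[p] = 0`, pro-`p`
descent) at the place `primePlace p`.  Covers 𝒞₇ × {7} (`seven_nsmul_eq_zero_padic`), the signed types `(p, I₀*)`, `p ≥ 5` (Part 48
`noPTorsion_padic_of_hasSignedLocalType_IstarZero`), every additive `p ≥ 11` (`Additive.eq_zero_of_prime_nsmul_eq_zero_of_addv_of_eleven_le`).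
CONDITIONAL on H2X′ only. [cite: Kato2004Asterisque, (14.9.1) (p. 239), (17.13.1)–(17.13.4) (pp. 279–280)] [cite: GreenbergLNM1716, §3 Lemma 3.1] -/
theorem exists_linearEquiv_fineSelmerDual_H2_of_noPTorsionPadic
    (hH2X' : Kato2004.exists_iwasawaH2Data_fineSelmerDual_embedding_loc)
    (W : WeierstrassCurve ℚ) [W.IsElliptic] (p : ℕ) [Fact p.Prime] [ContinuousSMul ℤ_[p] (W.tateModule p)]
    (κ : ZpExtension ℚ p) (γ : absoluteGaloisGroup ℚ) (hκ : κ.IsCyclotomic) (hγ : κ.IsTopGenerator γ) (hp2 : p ≠ 2)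
    (h4 : ∀ R : (W.baseChange ℚ_[p]).toAffine.Point, p • R = 0 → R = 0) (I : IwasawaH1Data W p κ γ) :
    ∃ J : IwasawaH2Data W p κ γ I, Nonempty ((W.fineSelmerDualData κ hγ).X ≃ₗ[IwasawaAlgebra p] J.H2) :=
  hH2X'.exists_linearEquiv_of_eq_bot hγ (primePlace p) hp2 hκ (coe_primesEquiv_primePlace p)
    (Summit.BirchSwinnertonDyer.BirchSwinnertonDyer.Theorems.TowerTorsionVanishing.fixedPoints_kerSubgroup_inf_decomp_eq_bot_of_noPTorsionPadic
      W p κ (primePlace p)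
      (coe_primesEquiv_primePlace p) h4) I

/-- … in particular on the rows of 19223 (signed type `(p, I₀*)`, `p ≥ 5`; `W` globally minimal).
[cite: Kato2004Asterisque, (14.9.1) (p. 239), (17.13.1) (p. 279)] [cite: Mazur1977, Ch. III §5, Step 1, p. 158] -/
theorem exists_linearEquiv_fineSelmerDual_H2_of_hasSignedLocalType_IstarZero
    (hH2X' : Kato2004.exists_iwasawaH2Data_fineSelmerDual_embedding_loc)
    (W : WeierstrassCurve ℚ) [W.IsElliptic] [W.IsGloballyMinimal] (p : ℕ) [Fact p.Prime]
    [ContinuousSMul ℤ_[p] (W.tateModule p)] (hp5 : 5 ≤ p) (hT : HasSignedLocalType W p (.Istar 0))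
    (κ : ZpExtension ℚ p) (γ : absoluteGaloisGroup ℚ) (hκ : κ.IsCyclotomic) (hγ : κ.IsTopGenerator γ) (I : IwasawaH1Data W p κ γ) :
    ∃ J : IwasawaH2Data W p κ γ I, Nonempty ((W.fineSelmerDualData κ hγ).X ≃ₗ[IwasawaAlgebra p] J.H2) :=
  exists_linearEquiv_fineSelmerDual_H2_of_noPTorsionPadic hH2X' W p κ γ hκ hγ (by omega)
    (noPTorsion_padic_of_hasSignedLocalType_IstarZero W p hp5 hT) I

end TameShortCut

end Summit.BirchSwinnertonDyer.Rank1Residual.Additive.StrictCount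

end
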